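import Summits.BirchSwinnertonDyer.Rank1Residual.P2.CongruentNumberEvenFiveFamilyDescent
import Summits.BirchSwinnertonDyer.Rank1Residual.P2.CongruentNumberSilentEvenFiveThetaDescentRungTwo
import Literature.NumberTheory.EllipticCurves.CongruentNumberEvenOneSelmerBound
import HarnessLib

/-!
# Cell `bsd-monsky`: the `k = 2` RUNG of the typed even Monsky law without a `2`-Selmer display

HONEST FRAMING (cell `bsd-monsky`, run/shared/lean/pub/bsd-monsky/; README §1, §3): the cell's theorem is Theorem 1.1 on
`𝒮⁻`; the rungs of C-P2-2 are RECORD («what the same argument gives», README §3); nothing is booked by this file.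
The `k = 2` rung `Conjectures.CongruentEvenBSDTwoAt 2` (all `n = 2p₁p₂ ≡ 6 (mod 8)` with Monsky's `s(n) = 1`:
`ord_{s=1} L(E_n, s) = 1 ∧ BSD(E_n, 2)`) was so far a theorem modulo {C-P2-1 input on `𝒮⁻`, U⁺ `hU`, GZK, and a
`2`-SELMER DISPLAY `hMe` | `hAo`} (`congruentEvenBSDTwoAt_two_of_congruentSilentEvenFiveBSDTwo`; the silent sub-rung
`CongruentSilentEvenBSDTwoAt 2` modulo {C-P2-1 input, Rédei–Reichardt}). The cells of the rung are (ordered pairs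
`p ≡ 1 (4)`, `q ≡ 3 (4)`): `p ≡ 5 (8)` either symbol, and `p ≡ 1 (8)` with `(p/q) = −1` (`(p/q) = +1` has `s = 3`). On
ALL of them `#Sel⁽²⁾(E_{2pq}/ℚ) ≤ 8` is now a tree theorem (`card_selmerGroup_two_le_eight_congruentNumberCurve_two_mul_five_mul`,
`…_two_mul_one_mod_eight_of_jacobiSym_eq_neg_one`: complete `2`-descent on Selmer classes, places `p`, `q`, `∞`, good
primes, and the `2`-adic place where `(2/q) = +1`), and rank one + `#Sel₂ ≤ 8` give `Ш[2^∞] = 0`. Hence: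

* `congruentSilentEvenBSDTwoAt_two_of_thetaDisplay_descent (hΘ)` / `…_of_cmPointGaloisData_descent (hCM)` /
  `…_of_cmPointClassFieldData_descent (hCF)` / `…_of_autSystem_descent (hSys⁷)` — the SILENT `k = 2` rung from ONE display
  ALONE (Rédei–Reichardt instantiated, no Selmer display);
* `analyticRank_eq_one_and_bsdp_two_pair_of_uPlus_descent` — the loud-cell engine: U⁺, GZK, `Σ₂′` odd, `#Sel₂ ≤ 8` (tree);
* **`congruentEvenBSDTwoAt_two_descent (hU) (hGZK) (h𝒮⁻ : CongruentSilentEvenFiveBSDTwo)`** and the assembled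
  `congruentEvenBSDTwoAt_two_of_cmPointGaloisData_descent (hU) (hGZK) (hCM)` — the whole `k = 2` rung from {U⁺, GZK, one
  display}; no Monsky 1990, no Heath-Brown 1994, no Aoki 1999 binder.

CONDITIONAL on the displays named; nothing asserted; the conjecture `Prop`s stay `@[conjecture]`; no mark moved.
[cite: Monsky1990MockHeegner, Remark (3) (p. 67)] [cite: TianYuanZhang2017, Thm. 1.1, Thm. 1.2, Thm. 3.5, §3]
[cite: SilvermanAEC2009, Prop. X.1.4, Example X.1.5, Prop. X.4.9, Thm. X.4.2] [cite: Miller2011LMS, Def. 1.1 (arXiv:1010.2431 p. 3)]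
-/

noncomputable section

open scoped Classical

open WeierstrassCurve Literature.NumberTheory.EllipticCurves
  Literature.NumberTheory.EllipticCurves.Rank1Residual
  Literature.NumberTheory.EllipticCurves.Rank1Residual.Typed
  Literature.NumberTheory.EllipticCurves.HeathBrown1994
  Literature.NumberTheory.EllipticCurves.HeathBrown1994.Families
  Literature.NumberTheory.EllipticCurves.Monsky1990
  Literature.NumberTheory.EllipticCurves.TianYuanZhang2017
  Literature.NumberTheory.QuadraticFields.RedeiReichardt
  Literature.NumberTheory.QuadraticForms

set_option autoImplicit false

namespace Summit.BirchSwinnertonDyer.Rank1Residual.P2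

open Conjectures Literature.NumberTheory.EllipticCurves.Tian2014 ThetaDescent

/-! ## §1 The SILENT `k = 2` rung from one display alone -/

/-- **The silent `k = 2` rung from the route-B display `K_B` ALONE** (Rédei–Reichardt instantiated; the `2`-Selmer input is
the tree's `2`-descent). CONDITIONAL; nothing asserted. [cite: Monsky1990MockHeegner, Remark (3) (p. 67)]
[cite: TianYuanZhang2017, Thm. 1.2, Thm. 3.5] [cite: SilvermanAEC2009, Prop. X.1.4, Prop. X.4.9] -/
theorem congruentSilentEvenBSDTwoAt_two_of_thetaDisplay_descent
    (hΘ : ∀ p q : ℕ, p.Prime → q.Prime → p % 8 = 5 → q % 4 = 3 → thetaGenusPointDatum p q) :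
    CongruentSilentEvenBSDTwoAt 2 :=
  congruentSilentEvenBSDTwoAt_two_of_congruentSilentEvenFiveBSDTwo redeiReichardt_fourTwoCard_classGroup_holds
    (congruentSilentEvenFiveBSDTwo_of_thetaDisplay_descent hΘ)

/-- **The silent `k = 2` rung from `tyz_cmPointGaloisData` ALONE.** CONDITIONAL; nothing asserted.
[cite: Monsky1990MockHeegner, Remark (3) (p. 67)] [cite: TianYuanZhang2017, Thm. 1.2, §3.1, Thm. 3.5, Thm. 3.6]
[cite: SilvermanAEC2009, Prop. X.1.4, Prop. X.4.9] -/
theorem congruentSilentEvenBSDTwoAt_two_of_cmPointGaloisData_descent (hCM : tyz_cmPointGaloisData) :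
    CongruentSilentEvenBSDTwoAt 2 :=
  congruentSilentEvenBSDTwoAt_two_of_congruentSilentEvenFiveBSDTwo redeiReichardt_fourTwoCard_classGroup_holds
    (congruentSilentEvenFiveBSDTwo_of_cmPointGaloisData_descent hCM)

/-- **The silent `k = 2` rung from `tyz_cmPointClassFieldData` ALONE.** CONDITIONAL; nothing asserted.
[cite: Monsky1990MockHeegner, Remark (3) (p. 67)] [cite: TianYuanZhang2017, Thm. 1.2, §3.1, Prop. 3.2, Thm. 3.5, Thm. 3.6]
[cite: Cox2013, Theorem 6.1 (ii) and Theorem 9.18] [cite: SilvermanAEC2009, Prop. X.1.4, Prop. X.4.9] -/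
theorem congruentSilentEvenBSDTwoAt_two_of_cmPointClassFieldData_descent (hCF : tyz_cmPointClassFieldData) :
    CongruentSilentEvenBSDTwoAt 2 :=
  congruentSilentEvenBSDTwoAt_two_of_congruentSilentEvenFiveBSDTwo redeiReichardt_fourTwoCard_classGroup_holds
    (congruentSilentEvenFiveBSDTwo_of_cmPointClassFieldData_descent hCF)

/-- **The silent `k = 2` rung from route A's aut system display `hSys⁷` ALONE.** CONDITIONAL; nothing asserted.
[cite: Monsky1990MockHeegner, Remark (3) (p. 67)] [cite: Tian2014, Thm. 2.8 (J132), Def. 2.7, Prop. 2.1, J124–J126]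
[cite: TianYuanZhang2017, Thm. 1.2, Thm. 3.3] [cite: SilvermanAEC2009, Prop. X.1.4, Prop. X.4.9] -/
theorem congruentSilentEvenBSDTwoAt_two_of_autSystem_descent (hSys : tian2014_system_sMinus_aut) :
    CongruentSilentEvenBSDTwoAt 2 :=
  congruentSilentEvenBSDTwoAt_two_of_congruentSilentEvenFiveBSDTwo redeiReichardt_fourTwoCard_classGroup_holds
    (congruentSilentEvenFiveBSDTwo_of_autSystem_descent hSys)

/-! ## §2 The loud cells: U⁺, GZK, `Σ₂′` odd and the tree's `2`-descent bound -/

/-- **The loud-cell engine without a `2`-Selmer display**: for distinct primes `p ≡ 1 (mod 4)`, `q ≡ 3 (mod 4)` with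
`Σ₂′(2pq)` odd and `#Sel₂(E_{2pq}) ≤ 8`: U⁺ gives `𝓛(2pq)` odd, `ord = 1` and the datum `L′ = 2²·𝓛²·Ω·Reg`; GZK gives rank
one; the Selmer bound gives `Ш[2^∞] = 0`; the fact-free door gives `BSD(E_{2pq}, 2)`. CONDITIONAL on `hU`, `hGZK`; nothing
asserted. [cite: TianYuanZhang2017, Thm. 1.1, Thm. 1.2, §1 (1.1)] [cite: SilvermanAEC2009, Thm. X.4.2] [cite: Miller2011LMS, Def. 1.1] -/
theorem analyticRank_eq_one_and_bsdp_two_pair_of_uPlus_descent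
    (hU : ∀ (n : ℕ), Squarefree n → (n % 8 = 5 ∨ n % 8 = 6 ∨ n % 8 = 7) →
      ∃ L : ℤ, IsScriptL n L ∧
        ((n % 8 = 5 ∨ n % 8 = 7) → (2 : ℤ) ∣ L →
          Even (genusSum₁ n fun d => genusClassNumber (GenusField d)) ∧
          Even (genusSum₂' n fun d => genusClassNumber (GenusField d))) ∧
        (n % 8 = 6 → (2 : ℤ) ∣ L → Even (genusSum₂' n fun d => genusClassNumber (GenusField d))))
    (hGZK : rank_eq_analyticRank_of_analyticRank_le_one) {p q : ℕ} (hp : p.Prime) (hq : q.Prime)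
    (hp4 : p % 4 = 1) (hq4 : q % 4 = 3)
    (hgen : Odd (genusSum₂' (2 * (p * q)) fun d => genusClassNumber (GenusField d)))
    (hsel : Nat.card ((congruentNumberCurve (2 * (p * q))).selmerGroup 2) ≤ 8) :
    (congruentNumberCurve (2 * (p * q))).analyticRank = 1 ∧ BSDp (congruentNumberCurve (2 * (p * q))) 2 := by
  have hp2 : p ≠ 2 := by omega
  have hq2 : q ≠ 2 := by omega
  have hne : p ≠ q := fun h => by omega
  have ht : ∀ i, ((![p, q] : Fin 2 → ℕ) i).Prime := fun i => by fin_cases i <;> assumption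
  have hodd : ∀ i, Odd ((![p, q] : Fin 2 → ℕ) i) := fun i => by
    fin_cases i
    · exact hp.odd_of_ne_two hp2
    · exact hq.odd_of_ne_two hq2
  have hinj : Function.Injective (![p, q] : Fin 2 → ℕ) := by
    intro i j hij
    fin_cases i <;> fin_cases j
    · rfl
    · exact absurd hij (by simpa using hne)
    · exact absurd hij (by simpa using (Ne.symm hne))
    · rfl
  have hn : 2 * ∏ i, (![p, q] : Fin 2 → ℕ) i = 2 * (p * q) := by rw [Fin.prod_univ_two]; rfl
  have hsq : Squarefree (2 * (p * q)) := hn ▸ squarefree_two_mul_prod_of_injective _ ht hodd hinj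
  have hn0 : 2 * (p * q) ≠ 0 := hsq.ne_zero
  haveI := isElliptic_congruentNumberCurve hn0
  haveI : Fact (Nat.Prime 2) := ⟨Nat.prime_two⟩
  have h6 : (2 * (p * q)) % 8 = 6 := by
    have : (p * q) % 4 = 3 := by rw [Nat.mul_mod, hp4, hq4]
    omega
  obtain ⟨Lz, hLodd, hr1, hderiv⟩ := rankOneDatum_of_uPlus_six hU hsq h6 hgen
  have hx : deriv (congruentNumberCurve (2 * (p * q))).entireLFunction 1 =
      (((2 : ℚ) ^ twoExponent (2 * (p * q)) * (Lz : ℚ) ^ 2 : ℚ) : ℂ) *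
        ((congruentNumberCurve (2 * (p * q))).realPeriodRat : ℂ) *
          ((congruentNumberCurve (2 * (p * q))).regulator : ℂ) := by
    rw [hderiv]; push_cast; ring
  obtain ⟨hrank, -⟩ := hGZK (congruentNumberCurve (2 * (p * q))) (le_of_eq hr1)
  rw [hr1] at hrank
  have hbot := primaryComponent_sha_two_eq_bot_of_card_selmerGroup_le_eight hn0 hrank hsel
  obtain ⟨he, htam⟩ := twoExponent_tamagawa_two_mul_prime_mul hp hq hp2 hq2 hne
  refine ⟨hr1, (bsdp_two_iff_of_LDerivOverOmegaReg_of_sha_two_eq_bot_of_torsionOrder_eq_four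
    (congruentNumberCurve (2 * (p * q))) hGZK hr1 hx hbot (torsionOrder_congruentNumberCurve hsq)).mpr ?_⟩
  rw [padicValRat_two_zpow_mul_sq hLodd, he, htam, padicValNat.prime_pow]
  norm_num

/-! ## §3 The whole `k = 2` rung from {U⁺, GZK, one display} -/

/-- **THE `k = 2` RUNG WITHOUT A `2`-SELMER DISPLAY**: modulo U⁺ (`hU`), GZK and C-P2-1 on `𝒮⁻` (`h`), the typed even Monsky
law holds at `k = 2` — silent cells (`p ≡ 5 (8)`, `(p/q) = −1`) by `h`; loud cells `p ≡ 5 (8)`, `(p/q) = +1` and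
`p ≡ 1 (8)`, `(p/q) = −1` by §2 with the tree's `2`-descent bound; `p ≡ 1 (8)`, `(p/q) = +1` has `s = 3`, not in the rung.
CONDITIONAL on `hU`, `hGZK`, `h`; nothing asserted. [cite: Monsky1990MockHeegner, Remark (3) (p. 67)]
[cite: TianYuanZhang2017, Thm. 1.1, Thm. 1.2] [cite: SilvermanAEC2009, Prop. X.1.4, Example X.1.5, Prop. X.4.9, Thm. X.4.2] -/
theorem congruentEvenBSDTwoAt_two_descent
    (hU : ∀ (n : ℕ), Squarefree n → (n % 8 = 5 ∨ n % 8 = 6 ∨ n % 8 = 7) →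
      ∃ L : ℤ, IsScriptL n L ∧
        ((n % 8 = 5 ∨ n % 8 = 7) → (2 : ℤ) ∣ L →
          Even (genusSum₁ n fun d => genusClassNumber (GenusField d)) ∧
          Even (genusSum₂' n fun d => genusClassNumber (GenusField d))) ∧
        (n % 8 = 6 → (2 : ℤ) ∣ L → Even (genusSum₂' n fun d => genusClassNumber (GenusField d))))
    (hGZK : rank_eq_analyticRank_of_analyticRank_le_one) (h : CongruentSilentEvenFiveBSDTwo) :
    CongruentEvenBSDTwoAt 2 := by
  intro t ht hinj h6 hs
  obtain ⟨p, q, hp, hq, hne, hp4, hq4, hpq, htt⟩ := exists_pair_of_two_mul_prod_mod_eight_six t ht hinj h6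
  rw [Fin.prod_univ_two, hpq]
  have hs' : monskySelmerRankEven ![p, q] = 1 ∨ monskySelmerRankEven ![q, p] = 1 := by
    rcases htt with rfl | rfl
    · exact Or.inl hs
    · exact Or.inr hs
  rcases jacobiSym_eq_one_or_eq_neg_one_of_prime_ne hp hq hne with hj | hj <;>
    rcases (show p % 8 = 1 ∨ p % 8 = 5 by omega) with h1 | h5
  · obtain ⟨h3, h3'⟩ := monskySelmerRankEven_one_pair_of_jacobiSym_eq_one hp hq h1 hq4 hj
    exfalso; rcases hs' with hs' | hs' <;> omega
  · exact analyticRank_eq_one_and_bsdp_two_pair_of_uPlus_descent hU hGZK hp hq hp4 hq4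
      (odd_genusSum₂'_genusField_two_mul_five_mul redeiReichardt_fourTwoCard_classGroup_holds hp hq h5 hq4 hj)
      (card_selmerGroup_two_le_eight_congruentNumberCurve_two_mul_five_mul hp hq h5 hq4)
  · exact analyticRank_eq_one_and_bsdp_two_pair_of_uPlus_descent hU hGZK hp hq hp4 hq4
      (odd_genusSum₂'_genusField_two_mul_one_pair redeiReichardt_fourTwoCard_classGroup_holds hp hq h1 hq4 hj)
      (card_selmerGroup_two_le_eight_congruentNumberCurve_two_mul_one_mod_eight_of_jacobiSym_eq_neg_one hp hq h1 hq4 hj)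
  · exact h p q hp hq h5 hq4 hj

/-- **The `k = 2` rung from {U⁺, GZK, `tyz_cmPointGaloisData`}** — no `2`-Selmer display. CONDITIONAL; nothing asserted.
[cite: Monsky1990MockHeegner, Remark (3) (p. 67)] [cite: TianYuanZhang2017, Thm. 1.1, Thm. 1.2, §3.1, Thm. 3.5, Thm. 3.6]
[cite: SilvermanAEC2009, Prop. X.1.4, Example X.1.5, Prop. X.4.9] -/
theorem congruentEvenBSDTwoAt_two_of_cmPointGaloisData_descent
    (hU : ∀ (n : ℕ), Squarefree n → (n % 8 = 5 ∨ n % 8 = 6 ∨ n % 8 = 7) →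
      ∃ L : ℤ, IsScriptL n L ∧
        ((n % 8 = 5 ∨ n % 8 = 7) → (2 : ℤ) ∣ L →
          Even (genusSum₁ n fun d => genusClassNumber (GenusField d)) ∧
          Even (genusSum₂' n fun d => genusClassNumber (GenusField d))) ∧
        (n % 8 = 6 → (2 : ℤ) ∣ L → Even (genusSum₂' n fun d => genusClassNumber (GenusField d))))
    (hGZK : rank_eq_analyticRank_of_analyticRank_le_one) (hCM : tyz_cmPointGaloisData) :
    CongruentEvenBSDTwoAt 2 :=
  congruentEvenBSDTwoAt_two_descent hU hGZK (congruentSilentEvenFiveBSDTwo_of_cmPointGaloisData_descent hCM)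

/-- **The `k = 2` rung from {U⁺, GZK, `hSys⁷`}** (route A) — no `2`-Selmer display. CONDITIONAL; nothing asserted.
[cite: Monsky1990MockHeegner, Remark (3) (p. 67)] [cite: Tian2014, Thm. 2.8 (J132), Def. 2.7, Prop. 2.1, J124–J126]
[cite: TianYuanZhang2017, Thm. 1.1, Thm. 1.2, Thm. 3.3] [cite: SilvermanAEC2009, Prop. X.1.4, Example X.1.5, Prop. X.4.9] -/
theorem congruentEvenBSDTwoAt_two_of_autSystem_descent
    (hU : ∀ (n : ℕ), Squarefree n → (n % 8 = 5 ∨ n % 8 = 6 ∨ n % 8 = 7) →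
      ∃ L : ℤ, IsScriptL n L ∧
        ((n % 8 = 5 ∨ n % 8 = 7) → (2 : ℤ) ∣ L →
          Even (genusSum₁ n fun d => genusClassNumber (GenusField d)) ∧
          Even (genusSum₂' n fun d => genusClassNumber (GenusField d))) ∧
        (n % 8 = 6 → (2 : ℤ) ∣ L → Even (genusSum₂' n fun d => genusClassNumber (GenusField d))))
    (hGZK : rank_eq_analyticRank_of_analyticRank_le_one) (hSys : tian2014_system_sMinus_aut) :
    CongruentEvenBSDTwoAt 2 :=
  congruentEvenBSDTwoAt_two_descent hU hGZK (congruentSilentEvenFiveBSDTwo_of_autSystem_descent hSys)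

end Summit.BirchSwinnertonDyer.Rank1Residual.P2

end
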